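import Summits.QuantumFields.YangMills.Theorems.BalabanUVNodesN11ResidualPinCompletion

/-!
# DAG node N11 — THE DIAGONAL PIN IS TRIVIAL ABOVE GENERATION 0: along the all-large-field history def-T's resummed 𝐓-step weight of the run is
# IDENTICALLY `1` at every level `k ≥ 1` (every (3.2)·(3.3)·(3.16) label of an old term with `Λ_k = ∅` extends it by `Ω_{k+1} = Λ_{k+1} = ∅`, and the
# labels resolve unity), so node00-def-K0a's residual of record `ZrOfRecord₁₃ θ p` has `ζ0_j(T) = 1`, `ζ0_j(∅) = 0` at the generations `1 ≤ j < K`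

Cell `pub-ymgap`, YM-PLAN Track A (HUMAN RULING D-0062), seat `pub-ymgap-dag-n11-d` (g7; R134 fan-out seat N11 [B14], strategy s2), route `BalabanUVNodes`
rev 22, item K1⁶ `StabilityBAtRecordR13SepCoPR` = stmt-QuantumFields-20507 (helper, count-neutral).  [III] = [Balaban1988Convergent].  Over n02-b∕def-T's
`Node00/StepWeightsOfRecord` (`wOfRecord` = the resummation `Σ_{t : σ(init s′) t = s′} ω(init s′) t` of the label weights; (O2) `labelUnity_ωOfRecord`;
`OmegaOfLabel_subset_Λ`), node00-def-K0a's `Node00/Record13ResidualsR` (FILE 17: `seqAllLargeOfRecord`, `stepWeightPinOfRecord₁₃`, `ZrOfRecord₁₃` + faces) and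
this seat's `…ResidualPinCompletion` (p531014: `seq_eq_seqAllLargeOfRecord`, uniqueness of the all-large-field index).

WHY THIS FILE.  This seat's cure of FINDING №7 pins the generation-`j` residual factor on `T` to `w_j(s′_j(p))(V_j, V̄_j)`, def-T's resummed step weight of
the run at the ALL-LARGE-FIELD new sequence of length `j+1`; node00-def-K0a typed it as `stepWeightPinOfRecord₁₃` ∕ `ZrOfRecord₁₃` (director-ym №174 (5)).
WHAT that pin IS above generation 0 was left implicit.  Here it is computed: for `k ≥ 1` the old term of the diagonal has `Λ_k = ∅`, so its large-field
region `Z_k = Λ_kᶜ` is the whole lattice, the (3.2) window `(Z̃_k^{∼4})ᶜ` is EMPTY — more simply, (2.1) forces `Ω_{k+1}(t) ⊆ Λ_k = ∅` for EVERY label `t`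
(`OmegaOfLabel_subset_Λ`) — hence every label extends the all-large-field index by `(∅, ∅)`, the resummation defining `w_k(s′_{k+1})` runs over ALL labels,
its front factor `χ_{k+1}(∅) ≡ 1`, and (O2) label-level unity gives `w_k(s′_{k+1})(U, V′) = 1` for ALL `(U, V′)` (not only on the averaging graph).  So the
cured residual is the TWO-POINT datum `ζ0_j(T) = 1, ζ0_j(∅) = 0` at `1 ≤ j < K` and carries def-T's (3.2)·(3.3) large-field structure ONLY at generation `0`
(where `Z_0 = ∅` and the window is the whole lattice).  Consequence for K1's lanes: above generation 0 the generation-`j` spec of this seat's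
`…ZetaSpecSucc` ∕ `…DiagonalAtZ` along the diagonal reads `ζ_j(T)·w_j(∅,∅,∅) = 1` — the diagonal's only non-trivial 𝐓-weight is the first one.

WHAT THIS FILE PROVES (0 `sorry`, 0 `def`, standard axioms; `N`-generic, every run, every `A₁`, every residual `ζ` of def-T's labels).
`OmegaOfLabel_seqAllLarge_eq_empty` ∕ `LambdaOfLabel_seqAllLarge_eq_empty` (`k ≥ 1`: every label's new regions are empty) · `σOfRecord_seqAllLarge (hk : 1 ≤ k) (t) :
σ (s′_k) t = s′_{k+1}` · `init_seqAllLargeOfRecord : (s′_{k+1}).init = s′_k` · ★ `wOfRecord_seqAllLarge_succ_eq_one (hζ : IsZetaUnity …) (hk : 1 ≤ k) (U V′) :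
wOfRecord … k s′_{k+1} U V′ = 1` · ★ `stepWeightPinOfRecord₁₃_eq_one (hζu) (hj : 1 ≤ j) (ω) = 1` · `ZrOfRecord₁₃_ζ0_univ_eq_one (hζu) (h1 : 1 ≤ j) (hj : j < K)` ·
`ZrOfRecord₁₃_ζ0_empty_eq_zero (hζu) (h1) (hj)`.

HONEST FRAMING.  Kernel bookkeeping on def-T's ∕ n02-b's typed resummation and K0a's typed pin (count-neutral); it describes the tree's cured residual, it
does not assert anything of Bałaban's (in print the all-large-field terms are controlled by the (2.28) bounds, [III] §3, not by this triviality).  N11 NOT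
discharged; counts unmoved (typed 28∕28 · discharged 5∕28).  One finite four-torus programme at fixed `ε = L^{−K}`; NOT ℝ⁴, NOT OS, NOT a mass gap, NOT Clay.
Sources: [III] (2.1) p.254, (3.2)–(3.5) p.265, (3.16) p.268, (3.20)–(3.21) p.269, §3 p.267, (1.11) p.248.
-/

noncomputable section

open scoped BigOperators

namespace Summit.QuantumFields.YangMills.Theorems.BalabanUVNodesN11DiagonalPinAboveZero

open Literature.MathematicalPhysics.QuantumFieldTheory.Balaban1983to89 T4Continuum Node00 Node00.Tk
open BalabanUVNodesN11ResidualPinCompletion (seq_eq_seqAllLargeOfRecord)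

variable {F : T4Family} {N : ℕ} [NeZero N]

/-! ## §1. Every label of the all-large-field old term of length `k ≥ 1` extends it by `(∅, ∅)` -/

section Labels

variable (ν : Stage7Numerics) (M : ℕ) (p : B12.RunParams) (g : ℕ → ℝ) {k : ℕ}

omit [NeZero N] in
/-- For `k ≥ 1`, every label's `Ω_{k+1}(t)` over the all-large-field old term is empty ((2.1): `Ω_{k+1} ⊆ Λ_k = ∅`). [cite: Balaban1988Convergent, (2.1) p.254, (3.5) p.265] -/
theorem OmegaOfLabel_seqAllLarge_eq_empty (hk : 1 ≤ k) (t : LbOfRecord F ν p g k) :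
    OmegaOfLabel F ν M p g k (seqAllLargeOfRecord F ν M g p.K k) t = ∅ := by
  have h := OmegaOfLabel_subset_Λ F ν M p g k (seqAllLargeOfRecord F ν M g p.K k) t hk
  rw [seqAllLargeOfRecord_Λ] at h
  exact Set.subset_empty_iff.mp h

omit [NeZero N] in
/-- … and so is every label's `Λ_{k+1}(t)` (`Λ_{k+1} ⊆ Ω_{k+1}`). [cite: Balaban1988Convergent, (2.1) p.254, (3.20) p.269] -/
theorem LambdaOfLabel_seqAllLarge_eq_empty (hk : 1 ≤ k) (t : LbOfRecord F ν p g k) :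
    LambdaOfLabel F ν M p g k (seqAllLargeOfRecord F ν M g p.K k) t = ∅ :=
  Set.subset_empty_iff.mp
    ((LambdaOfLabel_subset F ν M p g k _ t).trans (OmegaOfLabel_seqAllLarge_eq_empty ν M p g hk t).subset)

omit [NeZero N] in
/-- **EVERY LABEL EXTENDS THE ALL-LARGE-FIELD INDEX OF LENGTH `k ≥ 1` TO THE ONE OF LENGTH `k+1`** (`σ s′_k t = s′_{k+1}`).
[cite: Balaban1988Convergent, (2.1) p.254, (3.5) p.265, (3.20) p.269] -/
theorem σOfRecord_seqAllLarge (hk : 1 ≤ k) (t : LbOfRecord F ν p g k) :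
    σOfRecord F ν M p g k (seqAllLargeOfRecord F ν M g p.K k) t = seqAllLargeOfRecord F ν M g p.K (k + 1) := by
  refine seq_eq_seqAllLargeOfRecord ν M g p.K (k + 1) _ fun j _ hj => ?_
  rcases Nat.lt_or_ge k j with hlt | hle
  · obtain rfl : j = k + 1 := le_antisymm hj hlt
    rw [σOfRecord_Ω_succ]
    exact OmegaOfLabel_seqAllLarge_eq_empty ν M p g hk t
  · rw [← seq_init_Ω_of_le (σOfRecord F ν M p g k (seqAllLargeOfRecord F ν M g p.K k) t) hle, init_σOfRecord, seqAllLargeOfRecord_Ω]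

omit [NeZero N] in
/-- The old term of the all-large-field index of length `k+1` is the all-large-field index of length `k`. [cite: Balaban1988Convergent, (2.1) p.254 (bookkeeping)] -/
theorem init_seqAllLargeOfRecord (k : ℕ) : (seqAllLargeOfRecord F ν M g p.K (k + 1)).init = seqAllLargeOfRecord F ν M g p.K k :=
  seq_eq_seqAllLargeOfRecord ν M g p.K k _ fun j _ hj => by
    rw [seq_init_Ω_of_le (seqAllLargeOfRecord F ν M g p.K (k + 1)) hj, seqAllLargeOfRecord_Ω]

end Labels

/-! ## §2. ★ The resummed step weight of the run along the diagonal is `1` above level 0 -/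

section Weight

variable (ν : Stage7Numerics) (M : ℕ) (A₁ : ℝ) (p : B12.RunParams) (g : ℕ → ℝ) {k : ℕ}

/-- **★ `w_k(s′_{k+1})(U, V′) = 1` FOR `k ≥ 1` AND ALL `(U, V′)`**: the resummation defining def-T's step weight at the all-large-field new sequence runs over
ALL labels of the all-large-field old term (§1), the front factor `χ_{k+1}(∅)` is `1`, and the labels resolve unity ((O2) `labelUnity_ωOfRecord`, given unity
of the residual `ζ`). [cite: Balaban1988Convergent, (3.2)–(3.5) p.265, (3.16) p.268, (3.20)–(3.21) p.269, §3 p.267] -/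
theorem wOfRecord_seqAllLarge_succ_eq_one {ζ : ZetaOfRecord F N ν M} (hζ : IsZetaUnity F N ν M ζ) (hk : 1 ≤ k)
    (U : GaugeField (F.P p.K) k (SU N)) (V' : GaugeField (F.P p.K) (k + 1) (SU N)) :
    wOfRecord F N ν M A₁ ζ p g k (seqAllLargeOfRecord F ν M g p.K (k + 1)) U V' = 1 := by
  classical
  rw [wOfRecord_apply, resumWeights, init_seqAllLargeOfRecord,
    Finset.filter_true_of_mem fun t _ => σOfRecord_seqAllLarge ν M p g hk t]
  rw [← labelUnity_ωOfRecord F N ν M p g k A₁ hζ (seqAllLargeOfRecord F ν M g p.K k) U V']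
  refine Finset.sum_congr rfl fun t _ => ?_
  rw [σOfRecord_seqAllLarge ν M p g hk t,
    chiSeqOfRecord_eq_one_of_Omega_empty F N ν M g p.K (k + 1) _ (seqAllLargeOfRecord_Ω F ν M g p.K (k + 1) (k + 1)) V', one_mul]

end Weight

/-! ## §3. Hence node00-def-K0a's pin and cured residual above generation 0 -/

section Pin

variable {θ : Stage13Params F N} {p : B12.RunParams}

/-- **★ THE DIAGONAL PIN VALUE IS `1` AT EVERY GENERATION `j ≥ 1`** (unity of def-T's residual `ζ`). [cite: Balaban1988Convergent, (1.11) p.248, (3.16)–(3.20) pp.268–269, p.267] -/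
theorem stepWeightPinOfRecord₁₃_eq_one (hζu : IsZetaUnity F N θ.ν θ.τ9.M θ.ζ) {j : ℕ} (hj : 1 ≤ j)
    (ω : MultiCfg (F.P p.K) (SU N) (FluctV N)) : stepWeightPinOfRecord₁₃ F N θ p j ω = 1 :=
  wOfRecord_seqAllLarge_succ_eq_one θ.ν θ.τ9.M θ.A₁ p (gOfRecord₁₃ F N θ p) hζu hj _ _

/-- **THE CURED RESIDUAL ON `T` AT THE GENERATIONS `1 ≤ j < K` IS `1`.** [cite: Balaban1988Convergent, (1.11) p.248, (3.16) p.268, p.267] -/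
theorem ZrOfRecord₁₃_ζ0_univ_eq_one (hζu : IsZetaUnity F N θ.ν θ.τ9.M θ.ζ) {j : ℕ} (h1 : 1 ≤ j) (hj : j < p.K)
    (ω : MultiCfg (F.P p.K) (SU N) (FluctV N)) : (ZrOfRecord₁₃ F N θ p).ζ0 j Set.univ ω = 1 := by
  rw [ZrOfRecord₁₃_ζ0_univ hj, stepWeightPinOfRecord₁₃_eq_one hζu h1]

/-- **… AND ON `∅` IT IS `0`** (so at `1 ≤ j < K` the cured residual is the two-point datum `ζ0_j(T) = 1`, `ζ0_j(Y) = 0` otherwise).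
[cite: Balaban1988Convergent, (1.11) p.248, (3.16) p.268, p.267] -/
theorem ZrOfRecord₁₃_ζ0_empty_eq_zero (hζu : IsZetaUnity F N θ.ν θ.τ9.M θ.ζ) {j : ℕ} (h1 : 1 ≤ j) (hj : j < p.K)
    (ω : MultiCfg (F.P p.K) (SU N) (FluctV N)) : (ZrOfRecord₁₃ F N θ p).ζ0 j ∅ ω = 0 := by
  rw [ZrOfRecord₁₃_ζ0_empty hj, stepWeightPinOfRecord₁₃_eq_one hζu h1, sub_self]

end Pin

end Summit.QuantumFields.YangMills.Theorems.BalabanUVNodesN11DiagonalPinAboveZero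

end
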